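import Summits.Ventures.PackingBounds.Energy.TenPointCkSixXData1
import Summits.Ventures.PackingBounds.Energy.TenPointCkSixXData2
import Summits.Ventures.PackingBounds.Energy.TenPointCkSixXData3
import Summits.Ventures.PackingBounds.Energy.TenPointCkSixXData4
import Summits.Ventures.PackingBounds.Energy.TenPointCkSixXData5
import Summits.Ventures.PackingBounds.Energy.TenPointCkSixXData6
import Summits.Ventures.PackingBounds.Energy.TenPointCkSixXData7
import HarnessLib

/-!
# Integer congruence data `X = P (S·Y) Pᵀ` (rows of X: the table (collector of 7 part modules)) for the SOS block of `e3pt-sharp-n4N10ck6d8-rat.json`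
# (two orthogonal regular pentagons (4,10); ten points on S³, single SOS term, d = 8)

Framing: lottery ticket; floor = certified bounds/negative ranges. Venture `PackingBounds`, cell `pub-packcert`, energy family E3PT
(pub-packcert-energy gen 15; n = 4 kernel route). `bW6` = P scaled to integers (`256`·P; rows = the 165 monomials of degree ≤ 8 in
(u,v,t), columns = the 153 face-basis vectors), `xW6` = bW6 · yW6 · bW6ᵀ (165 × 165, exact integers), `scaleXW6` = 256² · S.
Checked by `decide +kernel` with `GramData.checkCongr` in `TenPointCkSixCongrFacts*`; the slack polynomial of the certificate is
`(1/scaleXW6) · mᵀ xW6 m` for the monomial vector `m` (`TenPointCkSixSOS`). Generator `pub-packcert-energy/code/e3pt/g15/e3pt_lean_n4y.py`.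
-/

namespace Summit.Ventures.PackingBounds.Energy.PentagonsSixD8

/-- The scale `256² · S` of `xW6` relative to the certificate's real Gram data. -/
def scaleXW6 : ℤ := 1661534994731144841129758825350430720

/-- data rows. -/
def xW6 : List (List ℤ) := [xW60, xW61, xW62, xW63, xW64, xW65, xW66, xW67, xW68, xW69, xW610, xW611, xW612, xW613, xW614, xW615, xW616, xW617, xW618, xW619, xW620, xW621, xW622, xW623, xW624, xW625, xW626, xW627, xW628, xW629, xW630, xW631, xW632, xW633, xW634, xW635, xW636, xW637, xW638, xW639, xW640, xW641, xW642, xW643, xW644, xW645, xW646, xW647, xW648, xW649, xW650, xW651, xW652, xW653, xW654, xW655, xW656, xW657, xW658, xW659, xW660, xW661, xW662, xW663, xW664, xW665, xW666, xW667, xW668, xW669, xW670, xW671, xW672, xW673, xW674, xW675, xW676, xW677, xW678, xW679, xW680, xW681, xW682, xW683, xW684, xW685, xW686, xW687, xW688, xW689, xW690, xW691, xW692, xW693, xW694, xW695, xW696, xW697, xW698, xW699, xW6100, xW6101, xW6102, xW6103, xW6104, xW6105, xW6106, xW6107, xW6108, xW6109, xW6110, xW6111, xW6112, xW6113, xW6114,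 xW6115, xW6116, xW6117, xW6118, xW6119, xW6120, xW6121, xW6122, xW6123, xW6124, xW6125, xW6126, xW6127, xW6128, xW6129, xW6130, xW6131, xW6132, xW6133, xW6134, xW6135, xW6136, xW6137, xW6138, xW6139, xW6140, xW6141, xW6142, xW6143, xW6144, xW6145, xW6146, xW6147, xW6148, xW6149, xW6150, xW6151, xW6152, xW6153, xW6154, xW6155, xW6156, xW6157, xW6158, xW6159, xW6160, xW6161, xW6162, xW6163, xW6164]

end Summit.Ventures.PackingBounds.Energy.PentagonsSixD8
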